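import Summits.RiemannHypothesis.RiemannHypothesis.Theorems.PfPersistenceGalerkinDensityTransfer
import Summits.RiemannHypothesis.RiemannHypothesis.Theorems.PfPersistenceGalerkinFejerProfile
import Summits.RiemannHypothesis.RiemannHypothesis.Theorems.PfPersistenceGalerkinEvenFormDomain
import Summits.RiemannHypothesis.RiemannHypothesis.Theorems.GroundBartaPolarPerronFrobeniusFormDomainEven
import Summits.RiemannHypothesis.RiemannHypothesis.Theorems.OddSectorOddOneSignedWindowsFormDomainTools
import Summits.RiemannHypothesis.RiemannHypothesis.Theorems.WeilGroundStateGroundStatesConvergeToXiStubDirichletEnergyMul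
import Summits.RiemannHypothesis.RiemannHypothesis.Theorems.RuelleBandExactFirstBandStubEvenCriterion
import HarnessLib

/-!
# GAL-1 density (ii‴) PROVED: smooth even tests are limits of cut-off Connes profiles in mass and in the
# Markov closed form (`testToClosedFormDensity`); the Galerkin ⇄ continuum dictionary of the cell closes

**mechanism/rigidity campaign; no RH claims.** RH-free form-domain analysis (pub-rhpf, cand-3 gen 6). The typed
density input `TestToClosedFormDensity` of `PfPersistenceGalerkinDensityTransfer` (barrier-typer gen 4, the ONE
input its floor transfer needs) is PROVED here, unconditionally:

* §1 `weilIncrement_le_linear`: a function `h` vanishing off `[-a, a]`, bounded by `ε` and `K`-Lipschitz on the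
  window has increments `D_t(h) ≤ (4aKε + 2ε²)·t` for all `t > 0` (pointwise indicator majorant; the product of the
  two bounds `|d| ≤ Kt`, `|d| ≤ 2ε` makes the estimate LINEAR in `t`, hence integrable against `ρ(t) ~ 1/(2t)`).
* §2 `tendsto_markovClosedForm`: along any sequence `f_k` of window functions with `‖f_k − g‖_∞ ≤ ε_k → 0` and a
  uniform Lipschitz bound on `f_k − g`, mass, pole form (`OddSector.tendsto_weilPoleForm_of_window`), every increment
  (`tendsto_weilIncrement_of_tendsto`) and — by dominated convergence with the integrable majorant
  `ρ(t)(2D_t(g) + 2Ct)` (`integrableOn_weilArchDensity_mul_weilIncrement`,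
  `dirichletMul_integrableOn_weilArchDensity_mul_self`) — the archimedean energy converge; hence so does the
  Markov closed form `P + 𝓔_a − M_a‖·‖²`.
* §3 `exists_cutoffProfile_near` (Fejér, file `PfPersistenceGalerkinFejerProfile`): such a sequence of CUT-OFF
  PROFILES exists for every smooth even real test on `[-a, a]`; `testToClosedFormDensity : TestToClosedFormDensity`.
* §4 by-name corollaries, now hypothesis-free: `testToGalerkinFormDensity` (ii″), the cell's typed dictionary
  `galerkinToContinuum : GalerkinToContinuum zetaDatum`, the EQUIVALENCE `galerkinFloorAt_iff` (Galerkin floor `-σ`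
  at `a` for all truncations ⇔ `-σ ≤ ε_ev(a)`), and the two RH-STRENGTH REDUCTIONS with their remaining hypotheses
  explicit and unclaimed: `riemannHypothesis_of_galerkinFloorSeq` (floors `-σ_k → 0` at `a_k → ∞`; G1.05/G1.14
  thermometer, label E1) and `riemannHypothesis_of_allWindowsPositive'` (all-window positivity of `ζ`'s blocks; the
  tree's even Weil criterion). Nobody has either hypothesis; nothing here bears on RH.

References: dominated convergence; Fejér [folklore]; E. Bombieri, *Remarks on Weil's quadratic functional in the
theory of prime numbers I*, Rend. Mat. Acc. Lincei 11 (2000) 183–233, §§3–5 (the Markov closed form) [folklore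
for the continuity statements]; the cell files cited above.
-/

set_option linter.dupNamespace false

noncomputable section

open Set MeasureTheory Filter
open scoped Topology ArithmeticFunction.vonMangoldt

namespace Summit.RiemannHypothesis.RiemannHypothesis.Theorems.PfPersistence

open Literature.NumberTheory.LFunctions Literature.NumberTheory.LFunctions.ConnesVanSuijlekom
open Summit.RiemannHypothesis.RiemannHypothesis.Theorems.WeilGroundStateMarkovPart
  (weilIncrement_add_le tendsto_weilIncrement_of_tendsto)
open Summit.RiemannHypothesis.RiemannHypothesis.Theorems.OddSector (tendsto_weilPoleForm_of_window)
open Summit.RiemannHypothesis.RiemannHypothesis.Theorems.PolarPerronFrobenius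
  (continuous_weilIncrement_of_memLp_window)
open Summit.RiemannHypothesis.RiemannHypothesis.Theorems.GroundStatesConvergeToXi
  (dirichletMul_integrableOn_weilArchDensity_mul_self)

namespace TestDensity

/-! ## 1. Increments of a small difference with a Lipschitz bound on the window are `O(t)` -/

/-- constants on bounded intervals are integrable. [folklore] -/
theorem integrable_indicator_Icc_const (l r c : ℝ) : Integrable ((Icc l r).indicator fun _ : ℝ ↦ c) :=
  (integrable_indicator_iff measurableSet_Icc).2 (integrableOn_const (measure_Icc_lt_top.ne))

/-- `∫ 𝟙_{[l, r]} c = (r − l) c`. [folklore] -/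
theorem integral_indicator_Icc_const {l r : ℝ} (h : l ≤ r) (c : ℝ) :
    ∫ x, (Icc l r).indicator (fun _ : ℝ ↦ c) x = (r - l) * c := by
  rw [integral_indicator_const c measurableSet_Icc, smul_eq_mul, Real.volume_real_Icc_of_le h]

variable {a ε K t : ℝ} {h : ℝ → ℂ}

/-- **pointwise majorant** of `|h(x+t) − h(x)|²` for `h` vanishing off `[-a, a]`, `|h| ≤ ε`, `K`-Lipschitz on the
window: `2Kεt` on the window (product of the bounds `Kt` and `2ε`), `ε²` on the two boundary strips of width `t`.
[folklore] -/
theorem norm_sq_sub_le_majorant (ht : 0 < t) (hε : 0 ≤ ε) (hK : 0 ≤ K)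
    (hs : ∀ x, x ∉ Icc (-a) a → h x = 0) (hb : ∀ x, ‖h x‖ ≤ ε)
    (hl : ∀ x ∈ Icc (-a) a, ∀ y ∈ Icc (-a) a, ‖h x - h y‖ ≤ K * |x - y|) (x : ℝ) :
    ‖h (x + t) - h x‖ ^ 2 ≤ (Icc (-a) a).indicator (fun _ ↦ 2 * K * ε * t) x +
      (Icc (a - t) a).indicator (fun _ ↦ ε ^ 2) x + (Icc (-a - t) (-a)).indicator (fun _ ↦ ε ^ 2) x := by
  have i1 : 0 ≤ (Icc (-a) a).indicator (fun _ ↦ 2 * K * ε * t) x :=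
    Set.indicator_nonneg (fun _ _ ↦ by positivity) _
  have i2 : 0 ≤ (Icc (a - t) a).indicator (fun _ ↦ ε ^ 2) x :=
    Set.indicator_nonneg (fun _ _ ↦ by positivity) _
  have i3 : 0 ≤ (Icc (-a - t) (-a)).indicator (fun _ ↦ ε ^ 2) x :=
    Set.indicator_nonneg (fun _ _ ↦ by positivity) _
  by_cases hx : x ∈ Icc (-a) a
  · by_cases hxt : x + t ∈ Icc (-a) a
    · have hd1 : ‖h (x + t) - h x‖ ≤ K * t := by
        have h1 := hl (x + t) hxt x hx
        rwa [show x + t - x = t by ring, abs_of_pos ht] at h1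
      have hd2 : ‖h (x + t) - h x‖ ≤ 2 * ε := (norm_sub_le _ _).trans (by linarith [hb (x + t), hb x])
      calc ‖h (x + t) - h x‖ ^ 2 = ‖h (x + t) - h x‖ * ‖h (x + t) - h x‖ := sq _
        _ ≤ K * t * (2 * ε) := mul_le_mul hd1 hd2 (norm_nonneg _) (by positivity)
        _ = (Icc (-a) a).indicator (fun _ ↦ 2 * K * ε * t) x := by rw [indicator_of_mem hx]; ring
        _ ≤ _ := by linarith
    · have hxa : x ∈ Icc (a - t) a := by
        refine ⟨?_, hx.2⟩
        by_contra hcon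
        exact hxt ⟨by linarith [hx.1], by linarith [not_le.mp hcon]⟩
      rw [hs _ hxt, zero_sub, norm_neg]
      calc ‖h x‖ ^ 2 ≤ ε ^ 2 := pow_le_pow_left₀ (norm_nonneg _) (hb x) 2
        _ = (Icc (a - t) a).indicator (fun _ ↦ ε ^ 2) x := by rw [indicator_of_mem hxa]
        _ ≤ _ := by linarith
  · by_cases hxt : x + t ∈ Icc (-a) a
    · have hxa : x ∈ Icc (-a - t) (-a) := by
        refine ⟨by linarith [hxt.1], ?_⟩
        by_contra hcon
        exact hx ⟨(not_le.mp hcon).le, by linarith [hxt.2]⟩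
      rw [hs _ hx, sub_zero]
      calc ‖h (x + t)‖ ^ 2 ≤ ε ^ 2 := pow_le_pow_left₀ (norm_nonneg _) (hb _) 2
        _ = (Icc (-a - t) (-a)).indicator (fun _ ↦ ε ^ 2) x := by rw [indicator_of_mem hxa]
        _ ≤ _ := by linarith
    · rw [hs _ hxt, hs _ hx, sub_self, norm_zero, zero_pow two_ne_zero]
      linarith

/-- **Increments of a small Lipschitz-controlled difference are `O(t)`, uniformly**: `D_t(h) ≤ (4aKε + 2ε²) t` for
all `t > 0`. [folklore] -/
theorem weilIncrement_le_linear (ha : 0 < a) (ht : 0 < t) (hε : 0 ≤ ε) (hK : 0 ≤ K)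
    (hs : ∀ x, x ∉ Icc (-a) a → h x = 0) (hb : ∀ x, ‖h x‖ ≤ ε)
    (hl : ∀ x ∈ Icc (-a) a, ∀ y ∈ Icc (-a) a, ‖h x - h y‖ ≤ K * |x - y|) :
    weilIncrement h t ≤ (4 * a * K * ε + 2 * ε ^ 2) * t := by
  have hI1 := integrable_indicator_Icc_const (-a) a (2 * K * ε * t)
  have hI2 := integrable_indicator_Icc_const (a - t) a (ε ^ 2)
  have hI3 := integrable_indicator_Icc_const (-a - t) (-a) (ε ^ 2)
  have hI12 : Integrable (fun x ↦ (Icc (-a) a).indicator (fun _ ↦ 2 * K * ε * t) x +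
      (Icc (a - t) a).indicator (fun _ ↦ ε ^ 2) x) := hI1.add hI2
  unfold weilIncrement
  calc ∫ x, ‖h (x + t) - h x‖ ^ 2 ≤ ∫ x, ((Icc (-a) a).indicator (fun _ ↦ 2 * K * ε * t) x +
      (Icc (a - t) a).indicator (fun _ ↦ ε ^ 2) x + (Icc (-a - t) (-a)).indicator (fun _ ↦ ε ^ 2) x) :=
        integral_mono_of_nonneg (Eventually.of_forall fun x ↦ by positivity) (hI12.add hI3)
          (Eventually.of_forall fun x ↦ norm_sq_sub_le_majorant ht hε hK hs hb hl x)
    _ = (a - -a) * (2 * K * ε * t) + (a - (a - t)) * ε ^ 2 + (-a - (-a - t)) * ε ^ 2 := by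
        rw [integral_add hI12 hI3, integral_add hI1 hI2, integral_indicator_Icc_const (by linarith),
          integral_indicator_Icc_const (by linarith), integral_indicator_Icc_const (by linarith)]
    _ = (4 * a * K * ε + 2 * ε ^ 2) * t := by ring

/-! ## 2. Mass, pole form and Dirichlet energy converge along uniformly-close window functions -/

/-- **Continuity of mass and of the Markov closed form along uniformly-close window functions with a uniform
Lipschitz bound on the differences.** [folklore] -/
theorem tendsto_markovClosedForm {a K : ℝ} (ha : 0 < a) (hK : 0 ≤ K) {g : ℝ → ℂ} (hg : IsWeilTest g)
    (hgs : tsupport g ⊆ Icc (-a) a) {f : ℕ → ℝ → ℂ} (hfm : ∀ k, MemLp (f k) 2)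
    (hfz : ∀ k x, x ∉ Icc (-a) a → f k x = 0) {ε : ℕ → ℝ} (hε0 : ∀ k, 0 < ε k) (hε1 : ∀ k, ε k ≤ 1)
    (hεt : Tendsto ε atTop (𝓝 0)) (hsup : ∀ k x, ‖f k x - g x‖ ≤ ε k)
    (hlip : ∀ k, ∀ x ∈ Icc (-a) a, ∀ y ∈ Icc (-a) a, ‖(f k x - g x) - (f k y - g y)‖ ≤ K * |x - y|) :
    Tendsto (fun k ↦ ∫ x, ‖f k x‖ ^ 2) atTop (𝓝 (∫ x, ‖g x‖ ^ 2)) ∧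
      Tendsto (fun k ↦ markovClosedForm a (f k)) atTop (𝓝 (markovClosedForm a g)) := by
  have hg2 : MemLp g 2 := hg.memLp_two
  have hgz : ∀ x, x ∉ Icc (-a) a → g x = 0 := fun x hx ↦
    image_eq_zero_of_notMem_tsupport fun h' ↦ hx (hgs h')
  -- `L²` convergence from the sup bound on the window
  have hL2 : Tendsto (fun k ↦ ∫ x, ‖f k x - g x‖ ^ 2) atTop (𝓝 0) := by
    have hbd : ∀ k, ∫ x, ‖f k x - g x‖ ^ 2 ≤ 2 * a * ε k := by
      intro k
      have hpt : ∀ x, ‖f k x - g x‖ ^ 2 ≤ (Icc (-a) a).indicator (fun _ ↦ ε k) x := by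
        intro x
        by_cases hx : x ∈ Icc (-a) a
        · rw [indicator_of_mem hx]
          calc ‖f k x - g x‖ ^ 2 ≤ ε k ^ 2 := pow_le_pow_left₀ (norm_nonneg _) (hsup k x) 2
            _ ≤ ε k := by nlinarith [hε0 k, hε1 k]
        · rw [indicator_of_notMem hx, hfz k x hx, hgz x hx, sub_self, norm_zero, zero_pow two_ne_zero]
      calc ∫ x, ‖f k x - g x‖ ^ 2 ≤ ∫ x, (Icc (-a) a).indicator (fun _ ↦ ε k) x :=
            integral_mono_of_nonneg (Eventually.of_forall fun x ↦ by positivity)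
              (integrable_indicator_Icc_const _ _ _) (Eventually.of_forall hpt)
        _ = 2 * a * ε k := by rw [integral_indicator_Icc_const (by linarith)]; ring
    refine squeeze_zero (fun k ↦ integral_nonneg fun x ↦ by positivity) hbd ?_
    simpa using hεt.const_mul (2 * a)
  have hmass : Tendsto (fun k ↦ ∫ x, ‖f k x‖ ^ 2) atTop (𝓝 (∫ x, ‖g x‖ ^ 2)) :=
    tendsto_integral_norm_sq hg2 hfm hL2
  have hpole : Tendsto (fun k ↦ weilPoleForm (f k)) atTop (𝓝 (weilPoleForm g)) :=
    tendsto_weilPoleForm_of_window hg2 hfm hgz hfz hL2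
  have hinc : ∀ t, Tendsto (fun k ↦ weilIncrement (f k) t) atTop (𝓝 (weilIncrement g t)) :=
    tendsto_weilIncrement_of_tendsto hg2 hfm hL2
  -- increments of `f_k` are dominated by `2 D_t(g) + 2 C t`, uniformly in `k`
  set C : ℝ := 4 * a * K + 2 with hC
  have hfinc : ∀ k t, 0 < t → weilIncrement (f k) t ≤ 2 * weilIncrement g t + 2 * (C * t) := by
    intro k t ht
    have hhm : MemLp (fun x ↦ f k x - g x) 2 := (hfm k).sub hg2
    have h1 : weilIncrement (fun x ↦ f k x - g x) t ≤ (4 * a * K * ε k + 2 * ε k ^ 2) * t :=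
      weilIncrement_le_linear ha ht (hε0 k).le hK (h := fun x ↦ f k x - g x)
        (fun x hx ↦ by simp only [hfz k x hx, hgz x hx, sub_self]) (hsup k) (hlip k)
    have h2 : (4 * a * K * ε k + 2 * ε k ^ 2) * t ≤ C * t := by
      refine mul_le_mul_of_nonneg_right ?_ ht.le
      have hKa : 0 ≤ 4 * a * K := by positivity
      nlinarith [hε0 k, hε1 k]
    have h3 : weilIncrement (fun x ↦ g x + (f k x - g x)) t ≤
        2 * weilIncrement g t + 2 * weilIncrement (fun x ↦ f k x - g x) t := weilIncrement_add_le hg2 hhm t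
    have e : (fun x ↦ g x + (f k x - g x)) = f k := funext fun x ↦ by ring
    rw [e] at h3
    linarith
  -- the archimedean energy converges (dominated convergence)
  have harch : Tendsto (fun k ↦ ∫ t in Ioi (0 : ℝ), weilArchDensity t * weilIncrement (f k) t) atTop
      (𝓝 (∫ t in Ioi (0 : ℝ), weilArchDensity t * weilIncrement g t)) := by
    refine tendsto_integral_of_dominated_convergence
      (fun t ↦ 2 * (weilArchDensity t * weilIncrement g t) + 2 * C * (weilArchDensity t * t))
      (fun k ↦ (measurable_weilArchDensity.mul
        (continuous_weilIncrement_of_memLp_window (hfm k) (hfz k)).measurable).aestronglyMeasurable)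
      (((integrableOn_weilArchDensity_mul_weilIncrement hg).const_mul 2).add
        (dirichletMul_integrableOn_weilArchDensity_mul_self.const_mul (2 * C)))
      (fun k ↦ (ae_restrict_iff' measurableSet_Ioi).2 (Eventually.of_forall fun t ht ↦ ?_))
      (Eventually.of_forall fun t ↦ (hinc t).const_mul _)
    have hρ : 0 < weilArchDensity t := weilArchDensity_pos ht
    rw [Real.norm_of_nonneg (mul_nonneg hρ.le (weilIncrement_nonneg _ _))]
    calc weilArchDensity t * weilIncrement (f k) t
        ≤ weilArchDensity t * (2 * weilIncrement g t + 2 * (C * t)) :=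
          mul_le_mul_of_nonneg_left (hfinc k t ht) hρ.le
      _ = 2 * (weilArchDensity t * weilIncrement g t) + 2 * C * (weilArchDensity t * t) := by ring
  have hD : Tendsto (fun k ↦ weilDirichletEnergy a (f k)) atTop (𝓝 (weilDirichletEnergy a g)) := by
    unfold weilDirichletEnergy
    exact (tendsto_finsetSum _ fun n _ ↦ (hinc _).const_mul _).add harch
  refine ⟨hmass, ?_⟩
  unfold markovClosedForm
  exact (hpole.add hD).sub (hmass.const_mul _)

end TestDensity

/-! ## 3. Uniform approximation of an even test by cut-off profiles (Fejér), with a uniform Lipschitz bound -/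

namespace FejerProfile

open Real

/-- **C^{0,1}-DENSITY OF CUT-OFF COSINE PROFILES IN EVEN TESTS** (the approximation half of GAL-1 (ii‴)): for a
smooth even real test `g` with `tsupport g ⊆ [-a, a]` there is `K ≥ 0` such that for every `ε > 0` some cut-off
profile `f = cutoffProfile (a, N) v` satisfies `‖f − g‖_∞ ≤ ε` and `f − g` is `K`-Lipschitz on `[-a, a]`
(`N`, `v` = the Fejér truncation and coefficients; `K = 2 Lip(g)`). [folklore] -/
theorem exists_cutoffProfile_near {a : ℝ} (ha : 0 < a) {g : ℝ → ℂ} (hg : IsWeilTest g)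
    (hs : tsupport g ⊆ Icc (-a) a) (hev : ∀ t, g (-t) = g t) (hre : ∀ t, (g t).im = 0) :
    ∃ K : ℝ, 0 ≤ K ∧ ∀ ε : ℝ, 0 < ε → ∃ (N : ℕ) (v : Fin (N + 1) → ℝ),
      (∀ x, ‖cutoffProfile ⟨a, N, ha⟩ v x - g x‖ ≤ ε) ∧
      ∀ x ∈ Icc (-a) a, ∀ y ∈ Icc (-a) a,
        ‖(cutoffProfile ⟨a, N, ha⟩ v x - g x) - (cutoffProfile ⟨a, N, ha⟩ v y - g y)‖ ≤ K * |x - y| := by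
  have hπ := Real.pi_pos
  -- the real form of `g`, its Lipschitz constant and sup
  set gr : ℝ → ℝ := fun x ↦ (g x).re with hgr
  have hgeq : ∀ x, g x = (gr x : ℂ) := fun x ↦ Complex.ext (by simp [hgr]) (by simp [hgr, hre x])
  have hgrc : Continuous gr := Complex.continuous_re.comp hg.1.continuous
  have hgrev : ∀ s, gr (-s) = gr s := fun s ↦ by simp only [hgr, hev]
  obtain ⟨K₀, hK₀⟩ := ContDiff.lipschitzWith_of_hasCompactSupport hg.2 hg.1 (by simp)
  obtain ⟨S, hS⟩ := hg.2.exists_bound_of_continuous hg.1.continuous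
  have hK : ∀ x y, |gr x - gr y| ≤ K₀ * |x - y| := by
    intro x y
    calc |gr x - gr y| = |(g x - g y).re| := by simp [hgr]
      _ ≤ ‖g x - g y‖ := Complex.abs_re_le_norm _
      _ = dist (g x) (g y) := (dist_eq_norm _ _).symm
      _ ≤ K₀ * dist x y := hK₀.dist_le_mul x y
      _ = K₀ * |x - y| := by rw [Real.dist_eq]
  have hSr : ∀ x, |gr x| ≤ S := fun x ↦ (Complex.abs_re_le_norm _).trans (hS x)
  have hK0 : (0 : ℝ) ≤ K₀ := K₀.2
  -- the periodisation
  set G := periodize a gr with hGdef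
  have hGK : ∀ x y, |G x - G y| ≤ K₀ * |x - y| := abs_periodize_sub_le hK0 hK
  have hGS : ∀ x, |G x| ≤ S := fun x ↦ hSr _
  have hGc : Continuous G := continuous_of_abs_sub_le hGK
  have hGp : Function.Periodic G (2 * a) := periodize_periodic a gr
  have hGeq : ∀ s ∈ Icc (-a) a, G s = gr s := fun s hs ↦ periodize_eq ha hgrev hs
  refine ⟨2 * K₀, by positivity, fun ε hε ↦ ?_⟩
  -- choose `δ`, then `M`
  set δ : ℝ := ε / (2 * (K₀ * (a / π) + 1)) with hδ
  have hKc : 0 ≤ K₀ * (a / π) := by positivity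
  have hδ0 : 0 < δ := by positivity
  have hδ1 : K₀ * (a / π) * δ ≤ ε / 2 := by
    rw [hδ, show K₀ * (a / π) * (ε / (2 * (K₀ * (a / π) + 1))) =
      ε / 2 * (K₀ * (a / π) / (K₀ * (a / π) + 1)) by field_simp]
    exact mul_le_of_le_one_right (by positivity) ((div_le_one (by positivity)).2 (by linarith))
  obtain ⟨M, hM⟩ := exists_nat_gt (2 * S * π ^ 2 / (δ ^ 2 * (ε / 2)))
  have hS0 : 0 ≤ S := (norm_nonneg _).trans (hS 0)
  have hM1 : 2 * S * π ^ 2 / (δ ^ 2 * (M + 1)) ≤ ε / 2 := by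
    rw [div_le_iff₀ (by positivity)]
    have h1 : 2 * S * π ^ 2 / (δ ^ 2 * (ε / 2)) * (δ ^ 2 * (ε / 2)) = 2 * S * π ^ 2 := by
      field_simp
    nlinarith [hM, sq_nonneg δ, mul_pos (pow_pos hδ0 2) (half_pos hε)]
  refine ⟨M, fejerVec a gr M, fun x ↦ ?_, fun x hx y hy ↦ ?_⟩
  · by_cases hx : x ∈ Icc (-a) a
    · rw [cutoffProfile_apply, indicator_of_mem hx, hgeq x, ← Complex.ofReal_sub, Complex.norm_real,
        Real.norm_eq_abs, show (⟨a, M, ha⟩ : Window).a = a from rfl,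
        ← fejerMean_eq_profile ha hGc hGp hGeq hgrev hgrc M x, ← hGeq x hx]
      calc |fejerMean a G M x - G x| ≤ K₀ * (a / π) * δ + 2 * S * π ^ 2 / (δ ^ 2 * (M + 1)) :=
            abs_fejerMean_sub_le ha hK0 hGK hGS M hδ0 x
        _ ≤ ε / 2 + ε / 2 := add_le_add hδ1 hM1
        _ = ε := by ring
    · rw [cutoffProfile_eq_zero_of_not_mem _ _ hx, image_eq_zero_of_notMem_tsupport (fun h ↦ hx (hs h)),
        sub_zero, norm_zero]
      exact hε.le
  · rw [cutoffProfile_apply, cutoffProfile_apply, indicator_of_mem hx, indicator_of_mem hy, hgeq x, hgeq y,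
      show (⟨a, M, ha⟩ : Window).a = a from rfl,
      ← fejerMean_eq_profile ha hGc hGp hGeq hgrev hgrc M x, ← fejerMean_eq_profile ha hGc hGp hGeq hgrev hgrc M y,
      ← hGeq x hx, ← hGeq y hy, ← Complex.ofReal_sub, ← Complex.ofReal_sub, ← Complex.ofReal_sub,
      Complex.norm_real, Real.norm_eq_abs]
    calc |fejerMean a G M x - G x - (fejerMean a G M y - G y)|
        = |(fejerMean a G M x - fejerMean a G M y) - (G x - G y)| := by ring_nf
      _ ≤ |fejerMean a G M x - fejerMean a G M y| + |G x - G y| := abs_sub _ _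
      _ ≤ K₀ * |x - y| + K₀ * |x - y| :=
          add_le_add (abs_fejerMean_sub_fejerMean_le hGK a M x y) (hGK x y)
      _ = 2 * K₀ * |x - y| := by ring

end FejerProfile

/-! ## 4. The typed density input and the hypothesis-free corollaries -/

open TestDensity FejerProfile

/-- **GAL-1 (ii‴) PROVED — `TestToClosedFormDensity`**: every smooth even real test on `[-a, a]` is approximated by
cut-off Connes profiles `cutoffProfile (a, N) v` in mass and in the Markov closed form `P + 𝓔_a − M_a‖·‖²`
(Fejér means of the even periodisation, §3, fed to the continuity statement of §2). RH-free. [folklore] -/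
theorem testToClosedFormDensity : TestToClosedFormDensity := by
  intro a ha g hg hs hev hre δ hδ
  obtain ⟨K, hK, hnear⟩ := exists_cutoffProfile_near ha hg hs hev hre
  have hε0 : ∀ k : ℕ, (0 : ℝ) < 1 / ((k : ℝ) + 1) := fun k ↦ by positivity
  have hε1 : ∀ k : ℕ, 1 / ((k : ℝ) + 1) ≤ 1 := fun k ↦
    div_le_one_of_le₀ (by linarith [k.cast_nonneg (α := ℝ)]) (by positivity)
  choose N v hsup hlip using fun k : ℕ ↦ hnear (1 / ((k : ℝ) + 1)) (hε0 k)
  obtain ⟨hm, hc⟩ := tendsto_markovClosedForm ha hK hg hs (f := fun k ↦ cutoffProfile ⟨a, N k, ha⟩ (v k))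
    (fun k ↦ memLp_cutoffProfile _ _) (fun k x hx ↦ cutoffProfile_eq_zero_of_not_mem _ _ hx)
    (ε := fun k : ℕ ↦ 1 / ((k : ℝ) + 1)) hε0 hε1 tendsto_one_div_add_atTop_nhds_zero_nat hsup hlip
  obtain ⟨k₁, hk₁⟩ := Metric.tendsto_atTop.1 hm δ hδ
  obtain ⟨k₂, hk₂⟩ := Metric.tendsto_atTop.1 hc δ hδ
  refine ⟨N (max k₁ k₂), v (max k₁ k₂), ?_, ?_⟩
  · have h := hk₁ (max k₁ k₂) (le_max_left _ _)
    rw [Real.dist_eq] at h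
    exact h.le
  · have h := hk₂ (max k₁ k₂) (le_max_right _ _)
    rw [Real.dist_eq] at h
    exact h.le

/-- **GAL-1 (ii″) PROVED — `TestToGalerkinFormDensity`** (by `testToGalerkinFormDensity_of_closedForm`). [folklore] -/
theorem testToGalerkinFormDensity : TestToGalerkinFormDensity :=
  testToGalerkinFormDensity_of_closedForm testToClosedFormDensity

/-- **THE CELL'S TYPED DICTIONARY `GalerkinToContinuum zetaDatum`, PROVED** (hypothesis-free form of
`galerkinToContinuum_of_galerkinDensity`): all-window positivity of `ζ`'s Galerkin blocks implies `Re Q(g) ≥ 0` for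
every smooth even real test. RH-free; asserts nothing about all-window positivity. [folklore] -/
theorem galerkinToContinuum : GalerkinToContinuum zetaDatum :=
  galerkinToContinuum_of_galerkinDensity testToGalerkinFormDensity

/-- **GAL-1 PROVED, hypothesis-free: Galerkin floors transfer to the continuum even ground energy** — a floor `-σ`
(`σ ≥ 0`) on `ζ`'s blocks at half-length `a` for EVERY truncation gives `-σ ≤ ε_ev(a)`. [folklore] -/
theorem neg_le_weilEvenGroundEnergy_of_galerkinFloorAt {a σ : ℝ} {ha : 0 < a} (hσ : 0 ≤ σ)
    (hfl : GalerkinFloorAt a ha σ) : -σ ≤ weilEvenGroundEnergy a :=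
  neg_le_weilEvenGroundEnergy_of_galerkinFloor' testToGalerkinFormDensity hσ hfl

/-- **GAL-0 + GAL-1 — THE EXACT DICTIONARY AT ONE HALF-LENGTH (PROVED, RH-free):** for `σ ≥ 0`, `ζ`'s Galerkin
blocks at `a` have the floor `-σ` at every truncation IFF `-σ ≤ ε_ev(a)` (the even-sector bottom of the window).
[folklore] -/
theorem galerkinFloorAt_iff {a σ : ℝ} (ha : 0 < a) (hσ : 0 ≤ σ) :
    GalerkinFloorAt a ha σ ↔ -σ ≤ weilEvenGroundEnergy a :=
  ⟨neg_le_weilEvenGroundEnergy_of_galerkinFloorAt hσ, galerkinFloorAt_of_neg_le_weilEvenGroundEnergy ha⟩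

/-- **THE G1.05 / G1.14 THERMOMETER REDUCTION, now modulo NOTHING but its floor hypothesis (RH-STRENGTH label E1;
conditional, no RH claim):** Galerkin floors `-σ_k` (all truncations) at half-lengths `a_k → ∞` with `σ_k → 0` imply
RH. Nobody has such floors; by `galerkinFloorAt_iff` they say exactly `liminf ε_ev(a_k) ≥ 0`. [folklore] -/
theorem riemannHypothesis_of_galerkinFloorSeq {a σ : ℕ → ℝ} (ha : ∀ k, 0 < a k)
    (hat : Tendsto a atTop atTop) (hσ : Tendsto σ atTop (𝓝 0))
    (hfl : ∀ k, GalerkinFloorAt (a k) (ha k) (σ k)) : RiemannHypothesis :=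
  riemannHypothesis_of_galerkinFloors' testToGalerkinFormDensity ha hat hσ hfl

/-- **THE CELL'S GLOBAL DICTIONARY, PROVED (RH-STRENGTH label; conditional, no RH claim):** all-window positivity
of `ζ`'s Galerkin datum implies RH (`riemannHypothesis_of_allWindowsPositive` fed with the proved dictionary and
the tree's even Weil criterion). Nobody has all-window positivity. [folklore] -/
theorem riemannHypothesis_of_allWindowsPositive' (hpos : AllWindowsPositive zetaDatum) : RiemannHypothesis :=
  riemannHypothesis_of_allWindowsPositive galerkinToContinuum
    RuelleBandExactFirstBand.riemannHypothesis_iff_evenWeilPositivity hpos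

end Summit.RiemannHypothesis.RiemannHypothesis.Theorems.PfPersistence
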